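import Mathlib.NumberTheory.LSeries.PrimesInAP
import Mathlib.NumberTheory.LegendreSymbol.QuadraticReciprocity
import Mathlib.Data.Nat.Factorization.Basic
import HarnessLib

/-!
# Route `ResidualThetaTransportAtTwo`, node 27436 (cruxes Kan⁺ stmt-BirchSwinnertonDyer-20688 / 21437): the AUXILIARY PRIME of the
# `q`-adic triangles (Dirichlet + quadratic reciprocity)

Cell `bsd-wall`, width seat `bsd-wall-rtt-p3-w2` g4 (2026-08-28). THEOREMS ONLY (pure arithmetic, no `χ`);
`--supports stmt-BirchSwinnertonDyer-20688`; BSD is not proved by this.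

MAIN (`exists_aux_prime`). For odd primes `p ≠ q`, `e ≥ 1` and a class `a` prime to `p` there is a prime `n > max(p, q)` with
`n ≡ a (mod p)`, `q^e ∣ n + 1`, `n ≡ 3 (mod 4)`, `gcd((n−1)/2, p−1) = 1` and `q^{(n−1)/2} ≡ 1 (mod n)`.
Construction: `n ≡ a (p)`, `≡ −1 (q^e)`, `≡ 3 (4)`, `≡ 2 (M)` with `M` the part of `p − 1` prime to `2q` (CRT + Dirichlet, Mathlib
`Nat.forall_exists_prime_gt_and_modEq`); then `(n−1)/2` is odd and prime to `p − 1` (a common odd prime `r` is `q`, contradicting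
`q ∣ n+1`, or divides `M`, contradicting `n ≡ 2 (r)`), and `q` is a square mod `n` by reciprocity (`n ≡ −1 (mod q)`, `n ≡ 3 (mod 4)`:
`(q/n) = ±(n/q) = ±(−1/q) = +1` in both cases `q ≡ 1, 3 (mod 4)`), so `q^{(n−1)/2} ≡ 1` (Euler). Consumed by `…CuspSpanRuleQ`:
`q^t ≡ 1 (mod n)` for every `t` divisible by `(n−1)/2`, and such `t` hit every class mod `p − 1`.

References: P. G. L. Dirichlet (1837) / Mathlib `PrimesInAP`; C. F. Gauss, *Disquisitiones* §4 (reciprocity) / Mathlib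
`legendreSym.quadratic_reciprocity`; [Pollack2003] Conj. 6.3 (the node these files serve).
-/

set_option autoImplicit false
set_option linter.dupNamespace false

namespace Summit.BirchSwinnertonDyer.BirchSwinnertonDyer.Theorems.SignedMuAtTwo

/-- **Reciprocity input.** For primes `q ≠ 2`, `n ≡ 3 (mod 4)` with `q ∣ n + 1`: `q` is a square mod `n`, i.e.
`q^{(n−1)/2} = 1` in `ZMod n` (`(q/n) = ±(n/q) = ±(−1/q) = 1`). [folklore] -/
theorem pow_half_eq_one_of_dvd_succ (q n : ℕ) (hq : q.Prime) (hn : n.Prime) (hq2 : q ≠ 2) (hn4 : n % 4 = 3)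
    (hqn : q ∣ n + 1) : (q : ZMod n) ^ (n / 2) = 1 := by
  haveI : Fact q.Prime := ⟨hq⟩
  haveI : Fact n.Prime := ⟨hn⟩
  have hn2 : n ≠ 2 := by intro h; rw [h] at hn4; norm_num at hn4
  have hneg : ((n : ℤ) : ZMod q) = ((-1 : ℤ) : ZMod q) := by
    have h0 : ((n + 1 : ℕ) : ZMod q) = 0 := (ZMod.natCast_eq_zero_iff _ _).mpr hqn
    push_cast at h0 ⊢
    linear_combination h0
  have hqn' : legendreSym q (n : ℤ) = legendreSym q (-1) := by
    unfold legendreSym; rw [hneg]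
  have hodd : q % 4 = 1 ∨ q % 4 = 3 := by
    have := Nat.odd_iff.mp (hq.eq_two_or_odd'.resolve_left hq2); omega
  have hL : legendreSym n (q : ℤ) = 1 := by
    rcases hodd with h1 | h3
    · rw [legendreSym.quadratic_reciprocity_one_mod_four h1 hn2, hqn', legendreSym.at_neg_one hq2,
        ZMod.χ₄_nat_one_mod_four h1]
    · rw [legendreSym.quadratic_reciprocity_three_mod_four h3 hn4, hqn', legendreSym.at_neg_one hq2,
        ZMod.χ₄_nat_three_mod_four h3]; norm_num
  have h := legendreSym.eq_pow n (q : ℤ)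
  rw [hL] at h
  push_cast at h
  exact h.symm

/-- Every odd prime divisor `r ≠ q` of `p − 1` divides `M := ordCompl[q] (ordCompl[2] (p − 1))`. [folklore] -/
theorem dvd_ordCompl_ordCompl {p q r : ℕ} (hp1 : p - 1 ≠ 0) (hq : q.Prime) (hr : r.Prime) (hr2 : r ≠ 2) (hrq : r ≠ q)
    (hrp : r ∣ p - 1) : r ∣ ordCompl[q] (ordCompl[2] (p - 1)) := by
  have hO : ordProj[2] (p - 1) * ordCompl[2] (p - 1) = p - 1 := Nat.ordProj_mul_ordCompl_eq_self _ _
  have hO0 : ordCompl[2] (p - 1) ≠ 0 := (Nat.ordCompl_pos 2 hp1).ne'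
  have hM : ordProj[q] (ordCompl[2] (p - 1)) * ordCompl[q] (ordCompl[2] (p - 1)) = ordCompl[2] (p - 1) :=
    Nat.ordProj_mul_ordCompl_eq_self _ _
  have hr2c : Nat.Coprime r (ordProj[2] (p - 1)) :=
    Nat.Coprime.pow_right _ ((Nat.coprime_primes hr Nat.prime_two).mpr hr2)
  have hrqc : Nat.Coprime r (ordProj[q] (ordCompl[2] (p - 1))) :=
    Nat.Coprime.pow_right _ ((Nat.coprime_primes hr hq).mpr hrq)
  have h1 : r ∣ ordCompl[2] (p - 1) := by
    rw [← hO] at hrp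
    exact hr2c.dvd_of_dvd_mul_left hrp
  rw [← hM] at h1
  exact hrqc.dvd_of_dvd_mul_left h1

/-- **The auxiliary prime.** For odd primes `p ≠ q`, `e ≥ 1` and `a` prime to `p`: a prime `n > max(p, q)` with `n ≡ a (mod p)`,
`q^e ∣ n + 1`, `n ≡ 3 (mod 4)`, `gcd((n−1)/2, p−1) = 1`, `q^{(n−1)/2} ≡ 1 (mod n)`. [folklore] -/
theorem exists_aux_prime (p q : ℕ) (hp : p.Prime) (hq : q.Prime) (hp2 : p ≠ 2) (hq2 : q ≠ 2) (hpq : p ≠ q)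
    {e : ℕ} (he : 1 ≤ e) (a : ℕ) (ha : ¬ p ∣ a) :
    ∃ n : ℕ, n.Prime ∧ p < n ∧ q < n ∧ n ≡ a [MOD p] ∧ q ^ e ∣ n + 1 ∧ n % 4 = 3 ∧
      Nat.Coprime (n / 2) (p - 1) ∧ (q : ZMod n) ^ (n / 2) = 1 := by
  have hp3 : 3 ≤ p := by
    have := hp.two_le; rcases Nat.lt_or_ge 2 p with h | h
    · omega
    · exfalso; exact hp2 (le_antisymm h hp.two_le)
  have hq3 : 3 ≤ q := by
    have := hq.two_le; rcases Nat.lt_or_ge 2 q with h | h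
    · omega
    · exfalso; exact hq2 (le_antisymm h hq.two_le)
  have hp1 : p - 1 ≠ 0 := by omega
  -- the modulus `M` (the part of `p − 1` prime to `2q`)
  set O : ℕ := ordCompl[2] (p - 1) with hOdef
  set M : ℕ := ordCompl[q] O with hMdef
  have hO0 : O ≠ 0 := (Nat.ordCompl_pos 2 hp1).ne'
  have hM0 : M ≠ 0 := (Nat.ordCompl_pos q hO0).ne'
  have h2O : ¬ 2 ∣ O := Nat.not_dvd_ordCompl Nat.prime_two hp1
  have hMO : M ∣ O := Nat.ordCompl_dvd O q
  have h2M : ¬ 2 ∣ M := fun h ↦ h2O (h.trans hMO)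
  have hqM : ¬ q ∣ M := Nat.not_dvd_ordCompl hq hO0
  have hMp : M ∣ p - 1 := hMO.trans (Nat.ordCompl_dvd (p - 1) 2)
  have hpM : ¬ p ∣ M := fun h ↦ by
    have := Nat.le_of_dvd (Nat.pos_of_ne_zero hM0) h
    have := Nat.le_of_dvd (by omega) hMp
    omega
  -- pairwise coprimality of the moduli `p`, `q^e`, `4`, `M`
  have cpq : Nat.Coprime p (q ^ e) := Nat.Coprime.pow_right _ ((Nat.coprime_primes hp hq).mpr hpq)
  have cp4 : Nat.Coprime p 4 := by
    have : Nat.Coprime p 2 := (Nat.coprime_primes hp Nat.prime_two).mpr hp2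
    simpa using this.pow_right 2
  have cq4 : Nat.Coprime (q ^ e) 4 := by
    have : Nat.Coprime q 2 := (Nat.coprime_primes hq Nat.prime_two).mpr hq2
    simpa using (this.pow_right 2).pow_left e
  have cpM : Nat.Coprime p M := (Nat.Prime.coprime_iff_not_dvd hp).mpr hpM
  have cqM : Nat.Coprime (q ^ e) M := ((Nat.Prime.coprime_iff_not_dvd hq).mpr hqM).pow_left e
  have c4M : Nat.Coprime 4 M := by
    have : Nat.Coprime 2 M := (Nat.Prime.coprime_iff_not_dvd Nat.prime_two).mpr h2M
    simpa using this.pow_left 2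
  have c1 : Nat.Coprime (p * q ^ e) 4 := Nat.Coprime.mul_left cp4 cq4
  have c2 : Nat.Coprime (p * q ^ e * 4) M := Nat.Coprime.mul_left (Nat.Coprime.mul_left cpM cqM) c4M
  -- CRT
  obtain ⟨r₁, hr₁p, hr₁q⟩ := Nat.chineseRemainder cpq a (q ^ e - 1)
  obtain ⟨r₂, hr₂pq, hr₂4⟩ := Nat.chineseRemainder c1 r₁ 3
  obtain ⟨r₃, hr₃pq4, hr₃M⟩ := Nat.chineseRemainder c2 r₂ 2
  have e2 : r₃ ≡ r₁ [MOD p * q ^ e] := (hr₃pq4.of_mul_right 4).trans hr₂pq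
  have h3p : r₃ ≡ a [MOD p] := (e2.of_mul_right (q ^ e)).trans hr₁p
  have h3q : r₃ ≡ q ^ e - 1 [MOD q ^ e] := (e2.of_mul_left p).trans hr₁q
  have h34 : r₃ ≡ 3 [MOD 4] := (hr₃pq4.of_mul_left (p * q ^ e)).trans hr₂4
  -- `r₃` is prime to the modulus
  have hqe1 : 1 ≤ q ^ e := Nat.one_le_pow _ _ hq.pos
  have cr_p : Nat.Coprime r₃ p := by
    rw [Nat.coprime_comm, Nat.Prime.coprime_iff_not_dvd hp]
    intro h
    exact ha ((Nat.modEq_zero_iff_dvd.mp (h3p.symm.trans (Nat.modEq_zero_iff_dvd.mpr h))))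
  have cr_q : Nat.Coprime r₃ (q ^ e) := by
    apply Nat.Coprime.pow_right
    rw [Nat.coprime_comm, Nat.Prime.coprime_iff_not_dvd hq]
    intro h
    have h1 : q ^ e ∣ r₃ + 1 := by
      have e1 : r₃ + 1 ≡ q ^ e - 1 + 1 [MOD q ^ e] := h3q.add_right 1
      rw [Nat.sub_add_cancel hqe1] at e1
      exact Nat.modEq_zero_iff_dvd.mp (e1.trans (Nat.modEq_zero_iff_dvd.mpr dvd_rfl))
    have h2 : q ∣ r₃ + 1 := (dvd_pow_self q (by omega)).trans h1
    have : q ∣ 1 := (Nat.dvd_add_right h).mp h2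
    exact hq.one_lt.ne' (Nat.dvd_one.mp this)
  have cr_4 : Nat.Coprime r₃ 4 := by
    have hodd : r₃ % 2 = 1 := by have := h34; unfold Nat.ModEq at this; omega
    have : Nat.Coprime r₃ 2 := Nat.coprime_two_right.mpr (Nat.odd_iff.mpr hodd)
    simpa using this.pow_right 2
  have cr_M : Nat.Coprime r₃ M := by
    have h1 : Nat.gcd r₃ M = Nat.gcd 2 M := hr₃M.gcd_eq
    rw [Nat.Coprime, h1]
    exact (Nat.Prime.coprime_iff_not_dvd Nat.prime_two).mpr h2M
  have hcop : Nat.Coprime r₃ (p * q ^ e * 4 * M) :=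
    Nat.Coprime.mul_right (Nat.Coprime.mul_right (Nat.Coprime.mul_right cr_p cr_q) cr_4) cr_M
  have hQ0 : p * q ^ e * 4 * M ≠ 0 := by positivity
  -- Dirichlet
  obtain ⟨n, hngt, hnprime, hnmod⟩ := Nat.forall_exists_prime_gt_and_modEq (max p q) (q := p * q ^ e * 4 * M)
    (a := r₃) hQ0 hcop
  have hnp : n ≡ a [MOD p] := (((hnmod.of_mul_right M).of_mul_right 4).of_mul_right (q ^ e)).trans h3p
  have hnq : n ≡ q ^ e - 1 [MOD q ^ e] := (((hnmod.of_mul_right M).of_mul_right 4).of_mul_left p).trans h3q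
  have hn4 : n % 4 = 3 := by
    have := (hnmod.of_mul_right M).of_mul_left (p * q ^ e) |>.trans h34
    unfold Nat.ModEq at this; simpa using this
  have hnM : n ≡ 2 [MOD M] := (hnmod.of_mul_left (p * q ^ e * 4)).trans hr₃M
  have hpn : p < n := lt_of_le_of_lt (le_max_left _ _) hngt
  have hqn : q < n := lt_of_le_of_lt (le_max_right _ _) hngt
  have hqdvd : q ^ e ∣ n + 1 := by
    have e1 : n + 1 ≡ q ^ e - 1 + 1 [MOD q ^ e] := hnq.add_right 1
    rw [Nat.sub_add_cancel hqe1] at e1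
    exact Nat.modEq_zero_iff_dvd.mp (e1.trans (Nat.modEq_zero_iff_dvd.mpr dvd_rfl))
  have hqdvd1 : q ∣ n + 1 := (dvd_pow_self q (by omega)).trans hqdvd
  -- `gcd((n−1)/2, p−1) = 1`
  have hcopr : Nat.Coprime (n / 2) (p - 1) := by
    apply Nat.coprime_of_dvd
    intro r hr hrn hrp
    have hrn1 : r ∣ n - 1 := by
      have : n - 1 = 2 * (n / 2) := by omega
      rw [this]; exact hrn.mul_left 2
    by_cases hr2 : r = 2
    · subst hr2
      have : (n / 2) % 2 = 1 := by omega
      omega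
    by_cases hrq : r = q
    · subst hrq
      have h2 : r ∣ (n + 1) - (n - 1) := Nat.dvd_sub hqdvd1 hrn1
      have : (n + 1) - (n - 1) = 2 := by omega
      rw [this] at h2
      have := Nat.le_of_dvd (by norm_num) h2
      omega
    · have hrM : r ∣ M := dvd_ordCompl_ordCompl hp1 hq hr hr2 hrq hrp
      have hn2r : n ≡ 2 [MOD r] := hnM.of_dvd hrM
      have hrn2 : r ∣ n - 2 := (Nat.modEq_iff_dvd' (by omega : 2 ≤ n)).mp hn2r.symm
      have h2 : r ∣ (n - 1) - (n - 2) := Nat.dvd_sub hrn1 hrn2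
      rw [show (n - 1) - (n - 2) = 1 by omega] at h2
      exact hr.one_lt.ne' (Nat.dvd_one.mp h2)
  exact ⟨n, hnprime, hpn, hqn, hnp, hqdvd, hn4, hcopr, pow_half_eq_one_of_dvd_succ q n hq hnprime hq2 hn4 hqdvd1⟩

end Summit.BirchSwinnertonDyer.BirchSwinnertonDyer.Theorems.SignedMuAtTwo
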